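import Mathlib
import HarnessLib
import Literature.AlgebraicGeometry.Ramification.InertiaStalkNormalSylow
import Literature.AlgebraicGeometry.Resolution.ResolutionOfSingularities
import Literature.AlgebraicGeometry.Resolution.CompleteLocalDomainNormalization
import Summits.ResolutionOfSingularities.ResolutionOfSingularities.Theorems.WildQuotientsWildQuotientResolutionPhaseZeroPClosed

/-!
# Phase 0 in dimension one: on a Dedekind `G`-scheme every inertia group is already p-closed (crux `WildQuotients.WildQuotientResolution`, line `Sketch`)

A TRUE SLICE of the open stub `stub_phaseZero` of skeleton `Sketch` (crux
stmt-ResolutionOfSingularities-15640): when the regular integral `X′` has dimension `≤ 1` — every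
local ring at a non-generic point is a discrete valuation ring — no blow-up is needed: the
inertia group at the generic point is trivial (faithful action over the separated base `X₁`),
and at every other point it is the inertia group of a DVR of characteristic `p`, hence p-closed
by `Literature.AlgebraicGeometry.Ramification.hasNormalSylow_inertiaSubgroup_of_isIntegral`
(Serre IV §2 Cor. 4, landed this cycle). So the identity model of
`PClosedCase.phaseZero_of_forall_hasNormalSylow` has all the properties Phase 0 asks for.
In every dimension the same two lemmas say that the NON-p-closed locus of a faithful action on a
regular scheme lives in codimension `≥ 2` — the starting point of the card's Phase 0.

* `inertiaSubgroup_genericPoint_eq_bot` — generic inertia of a faithful action is trivial.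
* `charP_stalk` — local rings of a scheme over a field of characteristic `p` have characteristic `p`.
* `phaseZero_of_stalks_dvr` — the slice (registered sub-goal of `stub_phaseZero`);
  `phaseZero_of_stalks_dim_one` — the same with `dim 𝒪_{X′,x} = 1` at non-generic points.
-/

-- single-problem summit: the doubled namespace component `ResolutionOfSingularities` is forced
set_option linter.dupNamespace false

open CategoryTheory AlgebraicGeometry TopologicalSpace
open Literature.AlgebraicGeometry.Resolution Literature.AlgebraicGeometry.Ramification

namespace Summit.ResolutionOfSingularities.ResolutionOfSingularities.Theorems.WildQuotientResolution.PhaseZeroDimOne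

/-- **Generic inertia is trivial**: for a faithful action of `G` on an integral scheme `X` over a
separated base (`σ g ≫ r = r`), the inertia group at the generic point is trivial — an element
fixing `Spec K(X) → X` (a dominant morphism) is the identity by
`ext_of_isDominant_of_isSeparated`. [folklore] -/
theorem inertiaSubgroup_genericPoint_eq_bot {X Y : Scheme.{0}} [IsIntegral X] (r : X ⟶ Y)
    [IsSeparated r] {G : Type} [Group G] (σ : G →* Aut X) (hr : ∀ g : G, (σ g).hom ≫ r = r)
    (hσ : Function.Injective σ) : inertiaSubgroup σ (genericPoint X) = ⊥ := by
  rw [eq_bot_iff]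
  intro g hg
  rw [Subgroup.mem_bot]
  have h := (mem_inertiaSubgroup_iff σ).mp hg
  haveI : IsDominant (X.fromSpecResidueField (genericPoint X)) := by
    refine ⟨Dense.mono ?_ (dense_iff_closure_eq.mpr (genericPoint_spec X))⟩
    rintro _ ⟨⟩
    exact ⟨default, Scheme.fromSpecResidueField_apply _ _⟩
  have hg1 : (σ g).hom = 𝟙 X :=
    ext_of_isDominant_of_isSeparated r (by rw [hr, Category.id_comp])
      (X.fromSpecResidueField (genericPoint X)) (by rw [h, Category.comp_id])
  apply hσ
  rw [map_one]
  exact Aut.ext hg1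

/-- Local rings of a scheme over a field of characteristic `p` have characteristic `p`
(`k → Γ(X, ⊤) → 𝒪_{X,x}` is a ring map out of a field into a non-trivial ring). [folklore] -/
theorem charP_stalk (p : ℕ) {k : Type} [Field k] [CharP k p] {X : Scheme.{0}}
    (g : X ⟶ Spec (.of k)) (x : X) : CharP (X.presheaf.stalk x) p :=
  (((X.presheaf.germ ⊤ x trivial).hom.comp
    ((g.appTop).hom.comp (Scheme.ΓSpecIso (.of k)).inv.hom)).charP_iff_charP p).mp inferInstance

/-- **Phase 0 on a Dedekind `G`-scheme** (true slice of `stub_phaseZero`): let `X′` be regular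
and integral, affine over `X₁` through the `G`-invariant `q`, itself over a field `k` of
characteristic `p`, with `G` finite acting FAITHFULLY, and suppose every non-generic point of `X′`
has a discrete valuation ring as local ring (`dim X′ ≤ 1`). Then every inertia group is p-closed
(generic point: trivial; closed points: Serre IV §2 Cor. 4), and the identity `X♯ = X′` is a model
with all seven properties demanded by Phase 0. [folklore] -/
theorem phaseZero_of_stalks_dvr (p : ℕ) [Fact p.Prime] {k : Type} [Field k] [CharP k p]
    {X' X₁ : Scheme.{0}} (f : X₁ ⟶ Spec (.of k)) (q : X' ⟶ X₁) [IsAffineHom q]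
    {G : Type} [Group G] [Finite G] (ρ : G →* Aut X') (hfaith : Function.Injective ρ)
    [IsIntegral X'] (hreg : Scheme.IsRegular X') (hρ : ∀ g : G, (ρ g).hom ≫ q = q)
    (hDVR : ∀ x : X', x ≠ genericPoint X' → IsDiscreteValuationRing (X'.presheaf.stalk x)) :
    ∃ (Xs : Scheme.{0}) (π : Xs ⟶ X') (ρs : G →* Aut Xs), IsProper π ∧ IsBirational π ∧
      IsIntegral Xs ∧ Scheme.IsRegular Xs ∧ (∀ g : G, (ρs g).hom ≫ π = π ≫ (ρ g).hom) ∧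
      (∀ x : Xs, HasNormalSylow p (inertiaSubgroup ρs x)) ∧
      ∀ x : Xs, ∃ U : Xs.Opens, IsAffineOpen U ∧ x ∈ U ∧ ∀ g : G, (ρs g).hom ⁻¹ᵁ U = U := by
  refine PClosedCase.phaseZero_of_forall_hasNormalSylow p q ρ hreg hρ fun x => ?_
  by_cases hx : x = genericPoint X'
  · subst hx
    rw [inertiaSubgroup_genericPoint_eq_bot q ρ hρ hfaith]
    exact HasNormalSylow.of_isPGroup IsPGroup.of_bot
  · haveI := hDVR x hx
    haveI := charP_stalk p (q ≫ f) x
    exact hasNormalSylow_inertiaSubgroup_of_isIntegral ρ p q hρ hfaith x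

/-- **Phase 0 in dimension one** (same slice, dimension form): if every local ring of the
regular integral `X′` at a non-generic point has Krull dimension `1` (so is a discrete valuation
ring, `isDiscreteValuationRing_of_isRegularLocalRing_of_ringKrullDim_eq_one`), the identity
model settles Phase 0. [folklore] -/
theorem phaseZero_of_stalks_dim_one (p : ℕ) [Fact p.Prime] {k : Type} [Field k] [CharP k p]
    {X' X₁ : Scheme.{0}} (f : X₁ ⟶ Spec (.of k)) (q : X' ⟶ X₁) [IsAffineHom q]
    {G : Type} [Group G] [Finite G] (ρ : G →* Aut X') (hfaith : Function.Injective ρ)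
    [IsIntegral X'] (hreg : Scheme.IsRegular X') (hρ : ∀ g : G, (ρ g).hom ≫ q = q)
    (hdim : ∀ x : X', x ≠ genericPoint X' → ringKrullDim (X'.presheaf.stalk x) = 1) :
    ∃ (Xs : Scheme.{0}) (π : Xs ⟶ X') (ρs : G →* Aut Xs), IsProper π ∧ IsBirational π ∧
      IsIntegral Xs ∧ Scheme.IsRegular Xs ∧ (∀ g : G, (ρs g).hom ≫ π = π ≫ (ρ g).hom) ∧
      (∀ x : Xs, HasNormalSylow p (inertiaSubgroup ρs x)) ∧
      ∀ x : Xs, ∃ U : Xs.Opens, IsAffineOpen U ∧ x ∈ U ∧ ∀ g : G, (ρs g).hom ⁻¹ᵁ U = U :=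
  phaseZero_of_stalks_dvr p f q ρ hfaith hreg hρ fun x hx =>
    haveI := hreg x
    isDiscreteValuationRing_of_isRegularLocalRing_of_ringKrullDim_eq_one _ (hdim x hx)

end Summit.ResolutionOfSingularities.ResolutionOfSingularities.Theorems.WildQuotientResolution.PhaseZeroDimOne
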